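import Summits.BirchSwinnertonDyer.BirchSwinnertonDyer.Theorems.ManinLocalTwoThreeUnitTwistOfLevelDifference

/-!
# THE EVEN SPAN LEMMA AND THE LEVEL-`n` DESCENT AT A PRIME-POWER MODULUS `p^e` (P-es-7, step H1a of MEMO-es §38.5-bis; cell
# bsd-f2-manin, seat `bsd-line-manin23-p2` gen 12): `…EvenSpanLemma` / `…TowerLevelDuality` §2 with `p ↦ p^e`

Summit `BirchSwinnertonDyer`, route `ManinLocalTwoThree`, crux C2 `ManinOddAtFour` (stmt-BirchSwinnertonDyer-22967), v14 stub 6 (blind-locus /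
Γ₁ half, es E-es-111♯ `GammaOneTowerUnitTwist`).  The tree's tower theorem `towerUnitTwist_holds` (…RigidityImpliesTower) consumes the
hypothesis `PlusIndexPrimeTo p f` only in its last line; E-es-111♯ drops it by re-running the whole proof at the modulus `p^(a+1)`,
`p^a ∥ [P(Λ_f) : P(Λ₁(f))]`.  Of the four homogenisation steps, H3/H4 are modulus-generic in the tree and H2 is `…MultiHubPrimePow`; THIS FILE is
H1, the (TV) input: the three washing lemmas of `…EvenSpanLemma`, `…TowerLevelDuality` §2, `…UnitTwistOfLevelDifference` with the prime
`p` replaced by the prime power `p^e` in every DIVISIBILITY and every «unit» clause `∀ s, p ∤ s → s·r/p ∉ ℤ̄ ↦ ∀ s, p ∤ s → s·r/p^e ∉ ℤ̄`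
(the multiplier `s` stays prime to `p`, NOT to `p^e`).  The proofs are the tree's, line by line; the only new arithmetic is the last step of
the span lemma (`p^e ∣ S·(φ(m)/2)·Δ` with `gcd(S·φ(m)/2, p) = 1 ⟹ p^e ∣ Δ`).

* `Int.primePow_dvd_sub_of_forall_even_isIntegral_charSum_div` — the relative even span lemma modulo `p^e`;
* `exists_primitive_even_unit_twist_of_levelDifference_primePow` — one level-`n` difference with plus part `p^e ∤ j` ⟹ a primitive even
  `χ` mod `qⁿ` with `S_χ = r·Ω⁺_f`, `s·r/p^e ∉ ℤ̄` (`p ∤ s`);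
* (sibling file `…WashingPrimePow`: Euler cofactors, `exists_unitTwist_of_levelDifference_primePow`, `plus_primePow_dvd_of_forall_not_unitTwist`).

HONEST FRAMING: bookkeeping toward P-es-7 (E-es-111♯); nothing about Manin's conjecture or BSD is asserted; C2/C3 OPEN.  No definitions,
no named facts, no sorry.
-/

set_option linter.dupNamespace false
set_option autoImplicit false

noncomputable section

open scoped Classical MatrixGroups ModularForm ComplexConjugate

open CongruenceSubgroup Complex Literature.NumberTheory.EllipticCurves
  Literature.NumberTheory.EllipticCurves.ModularForms
  Summit.BirchSwinnertonDyer.Rank1Residual.ManinAdditive.Gamma1Lattice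
  Summit.BirchSwinnertonDyer.Rank1Residual.ManinAdditive.KatoCurve

namespace Summit.BirchSwinnertonDyer.BirchSwinnertonDyer.Theorems.ManinLocalTwoThree

/-! ### §1 The relative even span lemma modulo `p^e` -/

/-- **The relative EVEN span lemma at a PRIME-POWER modulus `p^e`** (verbatim generalisation of
`Int.dvd_sub_of_forall_even_isIntegral_charSum_div_of_apply_ne_one`, `2p ↦ 2p^e`; last step `gcd(S·φ(m)/2, p) = 1`).
ORIGINAL DOCSTRING: **The relative EVEN mod-`p` span lemma** (Fourier descent on `(ℤ/m)ˣ/±1`, MEMO-an §71.3).  Let `m > 2`, `p` a prime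
with `p ∤ φ(m)/2`, `F : ℤ/m → ℤ` even and `h` a unit of `ℤ/m`.  If for every EVEN Dirichlet character `χ` mod `m` with
`χ(h) ≠ 1` there is `s ∈ ℕ`, `p ∤ s`, such that `s · F̂(χ) / (2p)` is an algebraic integer, then `p ∣ F(h·b) − F(b)` for
every unit `b`.  Proof: clear the multipliers (`S = ∏ s_χ`), invert over `(ℤ/m)ˣ/±1`
(`sum_even_inv_mul_charSum_eq`): `φ(m)(F(hb) − F(b)) = Σ_{χ even} (χ((hb)⁻¹) − χ(b⁻¹)) F̂(χ)`, where the even characters with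
`χ(h) = 1` drop out; so `S·φ(m)·(F(hb) − F(b))/(2p)` is a rational algebraic integer and `p ∣ S·(φ(m)/2)·(F(hb) − F(b))`.
[folklore] -/
theorem Int.primePow_dvd_sub_of_forall_even_isIntegral_charSum_div {m : ℕ} [NeZero m] (hm : 2 < m)
    {p : ℕ} (hp : p.Prime) (e : ℕ) (hpm : ¬ p ∣ m.totient / 2) (F : ZMod m → ℤ) (hF : ∀ a, F (-a) = F a)
    {h : ZMod m} (hh : IsUnit h)
    (hH : ∀ χ : DirichletCharacter ℂ m, χ.Even → χ h ≠ 1 →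
      ∃ s : ℕ, ¬ p ∣ s ∧ IsIntegral ℤ ((s : ℂ) * (∑ a : ZMod m, χ a * (F a : ℂ)) / (2 * (p : ℂ) ^ e)))
    {b : ZMod m} (hb : IsUnit b) : ((p : ℤ) ^ e) ∣ F (h * b) - F b := by
  -- one multiplier for all characters
  have h1 : ∀ χ : DirichletCharacter ℂ m, ∃ s : ℕ, ¬ p ∣ s ∧
      (χ.Even → χ h ≠ 1 → IsIntegral ℤ ((s : ℂ) * (∑ a : ZMod m, χ a * (F a : ℂ)) / (2 * (p : ℂ) ^ e))) := by
    intro χ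
    by_cases hχ : χ.Even ∧ χ h ≠ 1
    · obtain ⟨s, hs, hI⟩ := hH χ hχ.1 hχ.2
      exact ⟨s, hs, fun _ _ ↦ hI⟩
    · exact ⟨1, hp.one_lt.ne' ∘ Nat.dvd_one.mp, fun he hne ↦ (hχ ⟨he, hne⟩).elim⟩
  choose s hs hI using h1
  set S : ℕ := ∏ χ : DirichletCharacter ℂ m, s χ with hS
  have hpS : ¬ p ∣ S := by
    rw [hS, Prime.dvd_finsetProd_iff hp.prime]
    rintro ⟨χ, -, hχ⟩
    exact hs χ hχ
  have hSI : ∀ χ : DirichletCharacter ℂ m, χ.Even → χ h ≠ 1 →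
      IsIntegral ℤ ((S : ℂ) * (∑ a : ZMod m, χ a * (F a : ℂ)) / (2 * (p : ℂ) ^ e)) := by
    intro χ he hne
    have e : ((S : ℂ) * (∑ a : ZMod m, χ a * (F a : ℂ)) / (2 * (p : ℂ) ^ e)) =
        ((∏ ψ ∈ (Finset.univ.erase χ), s ψ : ℕ) : ℂ) *
          ((s χ : ℂ) * (∑ a : ZMod m, χ a * (F a : ℂ)) / (2 * (p : ℂ) ^ e)) := by
      rw [hS, ← Finset.mul_prod_erase Finset.univ s (Finset.mem_univ χ)]
      push_cast
      ring
    rw [e]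
    have hnat : ∀ K : ℕ, IsIntegral ℤ ((K : ℕ) : ℂ) := fun K ↦ by
      simpa using isIntegral_algebraMap (R := ℤ) (A := ℂ) (x := (K : ℤ))
    exact IsIntegral.mul (hnat _) (hI χ he hne)
  -- units
  obtain ⟨u, rfl⟩ := hh
  obtain ⟨v, rfl⟩ := hb
  have huv : IsUnit ((u : ZMod m) * (v : ZMod m)) := by rw [← Units.val_mul]; exact Units.isUnit _
  have hFC : ∀ a : ZMod m, ((F (-a) : ℤ) : ℂ) = (F a : ℂ) := fun a ↦ by rw [hF]
  -- Fourier inversion over `(ℤ/m)ˣ/±1` at `h b` and at `b`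
  have hFhb := DirichletCharacter.sum_even_inv_mul_charSum_eq (fun a ↦ (F a : ℂ)) hFC huv
  have hFb := DirichletCharacter.sum_even_inv_mul_charSum_eq (fun a ↦ (F a : ℂ)) hFC (Units.isUnit v)
  -- characters trivial on `h` drop out
  have hdrop : ∀ χ : DirichletCharacter ℂ m, χ (u : ZMod m) = 1 →
      χ ((u : ZMod m) * (v : ZMod m))⁻¹ = χ (v : ZMod m)⁻¹ := by
    intro χ hχ
    have hinv : χ ((u⁻¹ : (ZMod m)ˣ) : ZMod m) = 1 := by
      have := map_mul χ ((u⁻¹ : (ZMod m)ˣ) : ZMod m) (u : ZMod m)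
      rw [← Units.val_mul, inv_mul_cancel, Units.val_one, map_one, hχ, mul_one] at this
      exact this.symm
    rw [← Units.val_mul, ZMod.inv_coe_unit, ZMod.inv_coe_unit, mul_inv_rev, Units.val_mul, map_mul, hinv, mul_one]
  -- the algebraic integer `α = Σ_{χ even} (χ (hb)⁻¹ − χ b⁻¹) · (S F̂ χ / (2p))`
  set α : ℂ := ∑ χ : DirichletCharacter ℂ m,
    ((if χ.Even then χ ((u : ZMod m) * (v : ZMod m))⁻¹ else 0) - (if χ.Even then χ (v : ZMod m)⁻¹ else 0)) *
      ((S : ℂ) * (∑ a : ZMod m, χ a * (F a : ℂ)) / (2 * (p : ℂ) ^ e))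
    with hα
  have hαI : IsIntegral ℤ α := by
    refine IsIntegral.sum _ fun χ _ ↦ ?_
    by_cases he : χ.Even
    · rw [if_pos he, if_pos he]
      by_cases hχ : χ (u : ZMod m) = 1
      · rw [hdrop χ hχ, sub_self, zero_mul]
        exact isIntegral_zero
      · exact IsIntegral.mul ((DirichletCharacter.isIntegral_apply χ _).sub
          (DirichletCharacter.isIntegral_apply χ _)) (hSI χ he hχ)
    · rw [if_neg he, if_neg he, sub_self, zero_mul]
      exact isIntegral_zero
  -- `S · φ(m) · (F (h b) − F b) = 2p · α`
  have hp0 : (p : ℂ) ≠ 0 := by exact_mod_cast hp.ne_zero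
  have key : (((S : ℤ) * (m.totient : ℤ) * (F ((u : ZMod m) * (v : ZMod m)) - F (v : ZMod m)) : ℤ) : ℂ) /
      ((2 * p ^ e : ℕ) : ℤ) = α := by
    have e1 : α = (S : ℂ) / (2 * (p : ℂ) ^ e) *
        (∑ χ : DirichletCharacter ℂ m, (if χ.Even then χ ((u : ZMod m) * (v : ZMod m))⁻¹ else 0) *
          ∑ a : ZMod m, χ a * (F a : ℂ)) -
        (S : ℂ) / (2 * (p : ℂ) ^ e) *
        (∑ χ : DirichletCharacter ℂ m, (if χ.Even then χ (v : ZMod m)⁻¹ else 0) *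
          ∑ a : ZMod m, χ a * (F a : ℂ)) := by
      rw [hα, Finset.mul_sum, Finset.mul_sum, ← Finset.sum_sub_distrib]
      refine Finset.sum_congr rfl fun χ _ ↦ ?_
      field_simp
    rw [e1, hFhb, hFb]
    push_cast
    field_simp
  have hdvd : ((2 * p ^ e : ℕ) : ℤ) ∣ (S : ℤ) * (m.totient : ℤ) * (F ((u : ZMod m) * (v : ZMod m)) - F (v : ZMod m)) :=
    Int.dvd_of_isIntegral_intCast_div (by exact_mod_cast (Nat.mul_ne_zero two_ne_zero (pow_ne_zero e hp.ne_zero))) (key ▸ hαI)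
  -- `φ(m)` is even: remove the factor `2`, then the prime-to-`p` factors
  have heven : m.totient = 2 * (m.totient / 2) :=
    (Nat.mul_div_cancel' (even_iff_two_dvd.mp (Nat.totient_even hm))).symm
  have hdvd' : ((p : ℤ) ^ e) ∣ (S : ℤ) * ((m.totient / 2 : ℕ) : ℤ) * (F ((u : ZMod m) * (v : ZMod m)) - F (v : ZMod m)) := by
    have h2 : (S : ℤ) * (m.totient : ℤ) * (F ((u : ZMod m) * (v : ZMod m)) - F (v : ZMod m)) =
        2 * ((S : ℤ) * ((m.totient / 2 : ℕ) : ℤ) * (F ((u : ZMod m) * (v : ZMod m)) - F (v : ZMod m))) := by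
      conv_lhs => rw [heven]
      push_cast
      ring
    rw [h2] at hdvd
    push_cast at hdvd
    exact (mul_dvd_mul_iff_left (two_ne_zero' ℤ)).mp hdvd
  have hcop : IsCoprime ((p : ℤ) ^ e) ((S : ℤ) * ((m.totient / 2 : ℕ) : ℤ)) :=
    (IsCoprime.mul_right (Nat.isCoprime_iff_coprime.mpr ((Nat.Prime.coprime_iff_not_dvd hp).mpr hpS))
      (Nat.isCoprime_iff_coprime.mpr ((Nat.Prime.coprime_iff_not_dvd hp).mpr hpm))).pow_left
  rw [mul_comm] at hdvd'
  exact hcop.dvd_of_dvd_mul_right hdvd'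


section Duality

/-! ### §2 The `ℤ/m` bookkeeping (private copies of `…TowerLevelDuality` §1) -/

variable {N : ℕ} [NeZero N] (f : CuspForm (Gamma0 N) 2)

section Level

variable {m : ℕ} [NeZero m]

omit [NeZero N] [NeZero m] in
/-- `y_0 = 0`. -/
private theorem yP_zero : modularSymbol f (((0 : ZMod m).val : ℚ) / m) - modularSymbol f 0 = 0 := by
  simp [ZMod.val_zero]

omit [NeZero m] in
/-- `y_a ∈ Λ_f` for `m` prime to `N`. -/
private theorem yP_mem_periodLattice (hNm : IsCoprime (N : ℤ) m) (a : ZMod m) :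
    modularSymbol f ((a.val : ℚ) / m) - modularSymbol f 0 ∈ periodLattice f := by
  have e : ((a.val : ℤ) : ℚ) / ((m : ℤ) : ℚ) = (a.val : ℚ) / m := by push_cast; rfl
  rw [← e]
  exact modularSymbol_intCast_div_sub_zero_mem_periodLattice f hNm _ dvd_rfl

/-- `y_{−a} = conj y_a` for real `f`. -/
private theorem yP_neg (hreal : ∀ n, (cuspCoeff f n).im = 0) (a : ZMod m) :
    modularSymbol f (((-a).val : ℚ) / m) - modularSymbol f 0 =
      conj (modularSymbol f ((a.val : ℚ) / m) - modularSymbol f 0) := by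
  have h0 : conj (modularSymbol f 0) = modularSymbol f 0 := by
    have := modularSymbol_neg_eq_conj_holds f hreal 0
    rw [neg_zero] at this
    exact this.symm
  by_cases ha : a = 0
  · rw [ha, neg_zero, yP_zero, map_zero]
  · have hval : (-a).val = m - a.val := by rw [ZMod.neg_val, if_neg ha]
    have hlt : a.val ≤ m := (ZMod.val_lt a).le
    have hmQ : (m : ℚ) ≠ 0 := by exact_mod_cast (NeZero.ne m)
    have e : (((-a).val : ℚ) / m) = -((a.val : ℚ) / m) + ((1 : ℤ) : ℚ) := by
      rw [hval, Nat.cast_sub hlt]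
      field_simp
      push_cast
      ring
    rw [e, modularSymbol_add_intCast_holds f, modularSymbol_neg_eq_conj_holds f hreal, map_sub, h0]

/-- `{∞, b/m} = {∞, (b mod m)/m}`. -/
private theorem modularSymbol_intCast_div_eq_valP (b : ℤ) :
    modularSymbol f ((b : ℚ) / ((m : ℤ) : ℚ)) = modularSymbol f ((((b : ZMod m)).val : ℚ) / m) := by
  have hmQ : (m : ℚ) ≠ 0 := by exact_mod_cast (NeZero.ne m)
  have hv : (((b : ZMod m)).val : ℤ) = b % m := ZMod.val_intCast b
  have hb : (b : ℚ) / ((m : ℤ) : ℚ) = ((((b : ZMod m)).val : ℚ) / m) + ((b / m : ℤ) : ℚ) := by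
    have e1 : (b : ℚ) = ((b % m : ℤ) : ℚ) + (m : ℚ) * ((b / m : ℤ) : ℚ) := by
      exact_mod_cast (Int.emod_add_mul_ediv b m).symm
    have e2 : ((((b : ZMod m)).val : ℚ)) = ((b % m : ℤ) : ℚ) := by exact_mod_cast hv
    rw [e2, e1]
    push_cast
    field_simp
  rw [hb, modularSymbol_add_intCast_holds f]

/-- Half-sum identity: `2 · S_χ = Σ_a χ(a)·(y_a + ȳ_a)` for even `χ ≠ 1` and real `f`. -/
private theorem two_mul_S_eqP (hreal : ∀ n, (cuspCoeff f n).im = 0) {χ : DirichletCharacter ℂ m}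
    (hχ : χ ≠ 1) (hev : χ.Even) :
    2 * twistedSymbolSum f χ = ∑ a : ZMod m, χ a * ((modularSymbol f ((a.val : ℚ) / m) - modularSymbol f 0) +
      conj (modularSymbol f ((a.val : ℚ) / m) - modularSymbol f 0)) := by
  have hS : twistedSymbolSum f χ = ∑ a : ZMod m, χ a * (modularSymbol f ((a.val : ℚ) / m) - modularSymbol f 0) := by
    have : ∑ a : ZMod m, χ a * (modularSymbol f ((a.val : ℚ) / m) - modularSymbol f 0) =
        ∑ a : ZMod m, χ a * modularSymbol f ((a.val : ℚ) / m) - (∑ a : ZMod m, χ a) * modularSymbol f 0 := by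
      simp only [mul_sub, Finset.sum_sub_distrib, Finset.sum_mul]
    rw [this, χ.sum_eq_zero_of_ne_one hχ, zero_mul, sub_zero]
    rfl
  have hS' : twistedSymbolSum f χ =
      ∑ a : ZMod m, χ a * conj (modularSymbol f ((a.val : ℚ) / m) - modularSymbol f 0) := by
    rw [hS]
    refine Fintype.sum_equiv (Equiv.neg (ZMod m)) _ _ fun a ↦ ?_
    rw [Equiv.neg_apply, hev.eval_neg, yP_neg f hreal, Complex.conj_conj]
  rw [two_mul]
  nth_rewrite 1 [hS]
  rw [hS', ← Finset.sum_add_distrib]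
  refine Finset.sum_congr rfl fun a _ ↦ ?_
  ring

end Level

/-! ### §3 From ONE bad level-`n` difference to a primitive even twist that is a unit modulo `p^e` -/

variable {f}

/-- **Descent at level `n` from one bad difference, PRIME-POWER modulus** (`exists_primitive_even_unit_twist_of_levelDifference`
with `p ∤ j ↦ p^e ∤ j` and `s·r/p ↦ s·r/p^e`; proof verbatim through the prime-power even span lemma).
ORIGINAL DOCSTRING: **Descent at level `n` from one bad difference** (MEMO-an §71.3 «⟸»; the generation-law-free core of
`exists_primitive_even_unit_twist_of_towerGeneration`): a level-`n` tower difference (`n ≥ 2`) with plus part `≢ 0 (mod p)` yields a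
PRIMITIVE EVEN `χ` of conductor `qⁿ` with unit normalised twisted value. -/
theorem exists_primitive_even_unit_twist_of_levelDifference_primePow (hf : IsNewform0 f) (hQ : coeffField f = ⊥)
    {p : ℕ} (hp : p.Prime) (e : ℕ) {q : ℕ} [Fact q.Prime] (hq2 : q ≠ 2) (hqp : q ≠ p)
    (hqN : ¬ q ∣ N) (hpq : ¬ p ∣ (q - 1) / 2) {n : ℕ} (hn2 : 2 ≤ n) {b t : ℤ} (hb : ¬ (q : ℤ) ∣ b) {j : ℤ}
    (hj : (modularSymbol f (((b + t * (q : ℤ) ^ (n - 1) : ℤ) : ℚ) / (q : ℚ) ^ n) - modularSymbol f ((b : ℚ) / (q : ℚ) ^ n)) +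
        conj (modularSymbol f (((b + t * (q : ℤ) ^ (n - 1) : ℤ) : ℚ) / (q : ℚ) ^ n) -
          modularSymbol f ((b : ℚ) / (q : ℚ) ^ n)) = (j : ℂ) * (plusPeriod f : ℂ))
    (hjp : ¬ ((p : ℤ) ^ e) ∣ j) :
    ∃ (χ : DirichletCharacter ℂ (q ^ n)) (r : ℂ), χ.IsPrimitive ∧ χ.Even ∧
      twistedSymbolSum f χ = r * (plusPeriod f : ℂ) ∧ ∀ s : ℕ, ¬ p ∣ s → ¬ IsIntegral ℤ ((s : ℂ) * r / (p : ℂ) ^ e) := by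
  have hq : q.Prime := Fact.out
  have hq3 : 3 ≤ q := by
    rcases hq.eq_two_or_odd' with h | h
    · exact absurd h hq2
    · have := hq.two_le; rcases h with ⟨k, hk⟩; omega
  obtain ⟨hpos, -⟩ := plusPeriod_pos_and_realPeriods_eq isZLattice_periodLattice_holds hf hQ
  have hΩ : (plusPeriod f : ℂ) ≠ 0 := by exact_mod_cast hpos.ne'
  have hreal : ∀ n, (cuspCoeff f n).im = 0 := cuspCoeff_im_eq_zero_of_coeffField_eq_bot hQ
  haveI : NeZero (q ^ n) := ⟨pow_ne_zero _ hq.ne_zero⟩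
  have hqZ : IsCoprime (q : ℤ) b := by
    rw [Int.isCoprime_iff_gcd_eq_one]
    exact (Nat.Prime.coprime_iff_not_dvd hq).mpr fun h ↦ hb (Int.natCast_dvd.mpr h)
  have hNm : IsCoprime (N : ℤ) ((q ^ n : ℕ) : ℤ) := by
    rw [Nat.cast_pow]
    exact IsCoprime.pow_right (Nat.isCoprime_iff_coprime.mpr
      (Nat.coprime_comm.mp ((Nat.Prime.coprime_iff_not_dvd hq).mpr hqN)))
  -- the integer-valued even function `F` on `ℤ/qⁿ`
  have hF : ∀ a : ZMod (q ^ n), ∃ k : ℤ, (modularSymbol f ((a.val : ℚ) / (q ^ n : ℕ)) - modularSymbol f 0) +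
      conj (modularSymbol f ((a.val : ℚ) / (q ^ n : ℕ)) - modularSymbol f 0) = (k : ℂ) * (plusPeriod f : ℂ) :=
    fun a ↦ exists_int_add_conj_eq_mul_plusPeriod hf hQ (yP_mem_periodLattice f hNm a)
  choose F hF using hF
  have hFeven : ∀ a : ZMod (q ^ n), F (-a) = F a := by
    intro a
    have h1 := hF (-a)
    rw [yP_neg f hreal, Complex.conj_conj, add_comm, hF a] at h1
    exact_mod_cast (mul_right_cancel₀ hΩ h1).symm
  -- `j = F(b') − F(b)` for the residues `b' = b + t q^{n-1}`, `b`
  have hmq : (((q ^ n : ℕ) : ℤ) : ℚ) = (q : ℚ) ^ n := by push_cast; ring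
  have hzF : (j : ℂ) * (plusPeriod f : ℂ) =
      ((F ((b + t * (q : ℤ) ^ (n - 1) : ℤ) : ZMod (q ^ n)) - F ((b : ℤ) : ZMod (q ^ n)) : ℤ) : ℂ) *
        (plusPeriod f : ℂ) := by
    rw [← hj, ← hmq, modularSymbol_intCast_div_eq_valP f (b + t * (q : ℤ) ^ (n - 1)),
      modularSymbol_intCast_div_eq_valP f b]
    have e : modularSymbol f ((((b + t * (q : ℤ) ^ (n - 1) : ℤ) : ZMod (q ^ n)).val : ℚ) / (q ^ n : ℕ)) -
        modularSymbol f ((((b : ℤ) : ZMod (q ^ n)).val : ℚ) / (q ^ n : ℕ)) =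
        (modularSymbol f ((((b + t * (q : ℤ) ^ (n - 1) : ℤ) : ZMod (q ^ n)).val : ℚ) / (q ^ n : ℕ)) -
            modularSymbol f 0) -
          (modularSymbol f ((((b : ℤ) : ZMod (q ^ n)).val : ℚ) / (q ^ n : ℕ)) - modularSymbol f 0) := by ring
    rw [e, map_sub, Int.cast_sub, sub_mul, ← hF, ← hF]
    ring
  have hjF : j = F ((b + t * (q : ℤ) ^ (n - 1) : ℤ) : ZMod (q ^ n)) - F ((b : ℤ) : ZMod (q ^ n)) := by
    have := mul_right_cancel₀ hΩ hzF
    exact_mod_cast this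
  -- the residues are units; `u := b' · b⁻¹` lies in the kernel of reduction modulo `q^{n-1}`
  have hbcop : IsCoprime b ((q ^ n : ℕ) : ℤ) := by
    rw [Nat.cast_pow]; exact hqZ.symm.pow_right
  obtain ⟨k, hk⟩ : ∃ k, n - 1 = k + 1 := ⟨n - 2, by omega⟩
  have hb' : b + t * (q : ℤ) ^ (n - 1) = b + (q : ℤ) * (t * (q : ℤ) ^ k) := by rw [hk, pow_succ]; ring
  have hb'cop : IsCoprime (b + t * (q : ℤ) ^ (n - 1)) ((q ^ n : ℕ) : ℤ) := by
    rw [Nat.cast_pow, hb']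
    exact (hqZ.add_mul_left_right (t * (q : ℤ) ^ k)).symm.pow_right
  obtain ⟨ua, hua⟩ : IsUnit ((b : ℤ) : ZMod (q ^ n)) := (ZMod.coe_int_isUnit_iff_isCoprime b (q ^ n)).mpr hbcop.symm
  obtain ⟨ua', hua'⟩ : IsUnit (((b + t * (q : ℤ) ^ (n - 1) : ℤ)) : ZMod (q ^ n)) :=
    (ZMod.coe_int_isUnit_iff_isCoprime _ (q ^ n)).mpr hb'cop.symm
  have hu_mul : ((ua' * ua⁻¹ : (ZMod (q ^ n))ˣ) : ZMod (q ^ n)) * (ua : ZMod (q ^ n)) =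
      ((b + t * (q : ℤ) ^ (n - 1) : ℤ) : ZMod (q ^ n)) := by
    rw [← Units.val_mul, inv_mul_cancel_right, hua']
  have hu_ker : (ua' * ua⁻¹ : (ZMod (q ^ n))ˣ) ∈ (ZMod.unitsMap (pow_dvd_pow q (Nat.sub_le n 1))).ker := by
    rw [MonoidHom.mem_ker, map_mul, map_inv, mul_inv_eq_one]
    apply Units.ext
    rw [ZMod.unitsMap_val, ZMod.unitsMap_val, hua, hua', ZMod.cast_intCast (pow_dvd_pow q (Nat.sub_le n 1)),
      ZMod.cast_intCast (pow_dvd_pow q (Nat.sub_le n 1)), hk]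
    push_cast
    rw [← Nat.cast_pow, ZMod.natCast_self]
    ring
  -- `p ∤ φ(qⁿ)/2 = q^{n-1} (q-1)/2`, `qⁿ > 2`
  have hqodd : q % 2 = 1 := hq.eq_two_or_odd.resolve_left hq2
  have hφ : ¬ p ∣ (q ^ n).totient / 2 := by
    rw [Nat.totient_prime_pow hq (by omega), Nat.mul_div_assoc _ (show 2 ∣ q - 1 by omega)]
    intro h
    rcases (Nat.Prime.dvd_mul hp).mp h with h1 | h1
    · exact hqp ((Nat.prime_dvd_prime_iff_eq hp hq).mp (hp.dvd_of_dvd_pow h1)).symm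
    · exact hpq h1
  have h2m : 2 < q ^ n := lt_of_lt_of_le (by omega) (Nat.le_self_pow (by omega) q)
  -- §4: the even span lemma, contrapositively
  have hex : ∃ χ : DirichletCharacter ℂ (q ^ n), χ.Even ∧ χ ((ua' * ua⁻¹ : (ZMod (q ^ n))ˣ) : ZMod (q ^ n)) ≠ 1 ∧
      ∀ s : ℕ, ¬ p ∣ s → ¬ IsIntegral ℤ ((s : ℂ) * (∑ a : ZMod (q ^ n), χ a * (F a : ℂ)) / (2 * (p : ℂ) ^ e)) := by
    by_contra hcon
    push Not at hcon
    have h := Int.primePow_dvd_sub_of_forall_even_isIntegral_charSum_div h2m hp e hφ F hFeven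
      (Units.isUnit (ua' * ua⁻¹)) (fun χ he hne ↦ hcon χ he hne) (Units.isUnit ua)
    rw [hu_mul, hua, ← hjF] at h
    exact hjp h
  obtain ⟨χ, hev, hχu, hχ⟩ := hex
  have hprim : χ.IsPrimitive := DirichletCharacter.isPrimitive_of_apply_ne_one_of_mem_ker hq hu_ker hχu
  have hχ1 : χ ≠ 1 := fun h ↦ hχu (by rw [h, MulChar.one_apply_coe])
  -- §5: half-sum identity, `r = F̂(χ)/2`
  refine ⟨χ, (∑ a : ZMod (q ^ n), χ a * (F a : ℂ)) / 2, hprim, hev, ?_, ?_⟩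
  · have h2 := two_mul_S_eqP f hreal hχ1 hev
    simp_rw [hF, ← mul_assoc, ← Finset.sum_mul] at h2
    have : twistedSymbolSum f χ = (∑ a : ZMod (q ^ n), χ a * (F a : ℂ)) * (plusPeriod f : ℂ) / 2 := by
      rw [← h2]; ring
    rw [this]; ring
  · intro s hs hI
    refine hχ s hs ?_
    have e' : ((s : ℂ) * (∑ a : ZMod (q ^ n), χ a * (F a : ℂ)) / (2 * (p : ℂ) ^ e)) =
        (s : ℂ) * ((∑ a : ZMod (q ^ n), χ a * (F a : ℂ)) / 2) / (p : ℂ) ^ e := by ring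
    rwa [e']

end Duality

end Summit.BirchSwinnertonDyer.BirchSwinnertonDyer.Theorems.ManinLocalTwoThree

end
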